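import Literature.NumberTheory.GaloisRepresentations.ArtinRestriction
import Literature.NumberTheory.GaloisRepresentations.ReductionKernelTorsion
import Literature.NumberTheory.Automorphic.StrongArtinGL2
import Literature.NumberTheory.Automorphic.LanglandsTetrahedral
import HarnessLib

/-!
# `ResidualBianchiDoorMod2` (item stmt-Langlands-13459 of route ParityBlindBianchi): the 2-adic
# model `σ` of `ρ|_{Γ_K}` — finite image, irreducible, projectively `A₅`

Support item `Summit.Langlands.Langlands.Theses.ParityBlindBianchi.ResidualBianchiDoorMod2` asks,
for an irreducible icosahedral Artin representation `ρ : Γ_ℚ → GL₂(ℂ)`, a field isomorphism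
`ι : ℚ̄₂ ≃ ℂ` and an imaginary quadratic field `K`, for a continuous `σ : Γ_K → GL₂(ℚ̄₂)` with
`ι(σ(g)_{ij}) = ρ|_K(g)_{ij}`, finite image, irreducible, with projective image `A₅`, which is
moreover residually automorphic over `K`.  This file proves the **Galois-theoretic half**
(everything except residual automorphy), unconditionally:

* `exists_map_ringEquiv` — transport of a finite-image Galois representation along a field
  isomorphism `e : A ≃+* B` (continuity from the open kernel, `isOpen_ker_of_finite_range`,
  `MonoidHom.continuous_of_isOpen_ker`);
* `projectiveImage_map_ringEquiv` — the projective image is unchanged (up to the isomorphism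
  `PGL₂(e)`), `nonempty_projectiveImage_comp_mulEquiv_of_injOn`;
* `projectiveImage_comp_eq_of_index_two` — **restriction to an index-`2` subgroup does not shrink a
  simple projective image of order `≠ 2`** (the image has index `∣ 2`, an index-`2` subgroup of a
  simple group is trivial): `\bar{ρ|_K}(Γ_K) = \bar ρ(Γ_ℚ) ≅ A₅`;
* `exists_twoAdicModel` — the first four conjuncts of the item: `σ = GL₂(ι⁻¹) ∘ ρ ∘ res_{K/ℚ}`,
  finite image, irreducible (`isIrreducible_of_not_isCyclicType`: `A₅` is not cyclic), projective
  image `≅ A₅` (`isOpen_range_absGaloisRestrict_and_index`: `Γ_K ≤ Γ_ℚ` has index `[K:ℚ] = 2`).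

References: J.-P. Serre, *Abelian ℓ-adic representations* (1968), Ch. I §1.1; J. Tunnell,
Bull. AMS 5 (1981), p. 174 (restriction of projective images); F. Klein, *Ikosaeder* (1884), I §1.
-/

noncomputable section

set_option linter.dupNamespace false -- `Summit.Langlands.Langlands` is the mandated namespace (D-0017)

open scoped MatrixGroups
open Field Literature.NumberTheory.GaloisRepresentations Literature.NumberTheory.Automorphic
  Literature.NumberTheory.GaloisRepresentations.LocalRingReduction

namespace Summit.Langlands.Langlands.Theorems.ResidualBianchiDoorMod2

/-! ### Index-two subgroups and simple projective images -/

section IndexTwo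

variable {Γ Q : Type*} [Group Γ] [Group Q]

/-- The image of an index-`2` subgroup under a surjection onto a simple group of order `≠ 2` is
everything: it has index dividing `2`, and a subgroup of index `2` would be a proper non-trivial
normal subgroup. [folklore] -/
theorem map_eq_top_of_index_two (P : Γ →* Q) (hP : Function.Surjective P) (R : Subgroup Γ)
    (hR : R.index = 2) [IsSimpleGroup Q] (hcard : Nat.card Q ≠ 2) : R.map P = ⊤ := by
  have hdvd : (R.map P).index ∣ 2 := hR ▸ Subgroup.index_map_dvd R hP
  rcases (Nat.dvd_prime Nat.prime_two).mp hdvd with h1 | h2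
  · exact Subgroup.index_eq_one.mp h1
  · haveI : (R.map P).Normal := Subgroup.normal_of_index_eq_two h2
    rcases Subgroup.Normal.eq_bot_or_eq_top (inferInstance : (R.map P).Normal) with hb | ht
    · rw [hb, Subgroup.index_bot] at h2
      exact (hcard h2).elim
    · exact ht

variable {n : Type*} [Fintype n] [DecidableEq n] {R : Type*} [CommRing R] {Γ' : Type*} [Group Γ']

/-- **Restriction to an index-two subgroup does not shrink a simple projective image of order
`≠ 2`.**  If `ρ : Γ → GL_n(R)` has simple projective image `\bar ρ(Γ)` with `#\bar ρ(Γ) ≠ 2`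
(e.g. `≅ A₅`) and `r : Γ' → Γ` has image of index `2` (e.g. `Γ_K → Γ_ℚ` for a quadratic
field `K`), then `\bar{ρ ∘ r}(Γ') = \bar ρ(Γ)` as subgroups of `PGL_n(R)`. [folklore] -/
theorem projectiveImage_comp_eq_of_index_two (ρ : Γ →* GL n R) (r : Γ' →* Γ)
    (hr : r.range.index = 2) (hs : IsSimpleGroup (projectiveImage ρ))
    (hc : Nat.card (projectiveImage ρ) ≠ 2) :
    projectiveImage (ρ.comp r) = projectiveImage ρ := by
  set P : Γ →* projectiveImage ρ := (Matrix.ProjGenLinGroup.mk.comp ρ).rangeRestrict with hPdef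
  have hP : Function.Surjective P := MonoidHom.rangeRestrict_surjective _
  have hmap : (r.range).map P = ⊤ := map_eq_top_of_index_two P hP r.range hr hc
  have h2 : Matrix.ProjGenLinGroup.mk.comp ρ = (projectiveImage ρ).subtype.comp P :=
    (MonoidHom.subtype_comp_rangeRestrict _).symm
  show (Matrix.ProjGenLinGroup.mk.comp (ρ.comp r)).range = (Matrix.ProjGenLinGroup.mk.comp ρ).range
  rw [← MonoidHom.comp_assoc, MonoidHom.range_comp, h2, ← Subgroup.map_map, hmap,
    ← MonoidHom.range_eq_map, Subgroup.range_subtype]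
  rfl

end IndexTwo

/-! ### The icosahedral group -/

section Icosahedral

variable {P : Type*} [Group P]

/-- A group isomorphic to `A₅` is simple. [folklore] -/
theorem isSimpleGroup_of_mulEquiv_alternatingGroup (e : P ≃* alternatingGroup (Fin 5)) :
    IsSimpleGroup P := by
  haveI : IsSimpleGroup (alternatingGroup (Fin 5)) := alternatingGroup.isSimpleGroup (by simp)
  haveI : Nontrivial P := e.toEquiv.nontrivial
  exact IsSimpleGroup.isSimpleGroup_of_surjective e.symm.toMonoidHom e.symm.surjective

/-- A group isomorphic to `A₅` has `60 ≠ 2` elements. [folklore] -/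
theorem card_ne_two_of_mulEquiv_alternatingGroup (e : P ≃* alternatingGroup (Fin 5)) :
    Nat.card P ≠ 2 := by
  rw [Nat.card_congr e.toEquiv, nat_card_alternatingGroup, Nat.card_eq_fintype_card,
    Fintype.card_fin]
  decide

/-- `A₅` has two non-commuting elements. [folklore] -/
theorem exists_mul_ne_alternatingGroup_fin_five :
    ∃ a b : alternatingGroup (Fin 5), a * b ≠ b * a := by decide

/-- A representation of icosahedral type is not of cyclic type. [folklore] -/
theorem not_isCyclicType_of_mulEquiv_alternatingGroup {G : Type*} [Group G] {n : Type*}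
    [Fintype n] [DecidableEq n] {R : Type*} [CommRing R] {ρ : G →* GL n R}
    (e : projectiveImage ρ ≃* alternatingGroup (Fin 5)) : ¬ IsCyclicType ρ := by
  obtain ⟨a, b, hab⟩ := exists_mul_ne_alternatingGroup_fin_five
  exact not_isCyclic_of_mulEquiv_of_ne e hab

end Icosahedral

/-! ### Transport along a field isomorphism -/

section Transport

variable {F : Type*} [Field F] {A B : Type*} [Field A] [TopologicalSpace A] [T2Space A]
  [Field B] [TopologicalSpace B] [IsTopologicalRing B] {n : ℕ}

/-- `PGL_n` of a ring isomorphism is injective (it has `PGL_n(e⁻¹)` as a left inverse). [folklore] -/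
theorem projGenLinGroup_map_injective {R S : Type*} [CommRing R] [CommRing S] {m : Type*}
    [Fintype m] [DecidableEq m] (e : R ≃+* S) :
    Function.Injective (Matrix.ProjGenLinGroup.map (n := m) e.toRingHom) := by
  intro x y hxy
  have h := congrArg (Matrix.ProjGenLinGroup.map (n := m) e.symm.toRingHom) hxy
  rwa [← MonoidHom.comp_apply, ← MonoidHom.comp_apply, ← Matrix.ProjGenLinGroup.map_comp,
    RingEquiv.symm_toRingHom_comp_toRingHom, Matrix.ProjGenLinGroup.map_id, MonoidHom.id_apply,
    MonoidHom.id_apply] at h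

/-- **Transport of a finite-image Galois representation along a field isomorphism.**  For
`ρ : Γ_F → GL_n(A)` continuous with finite image and `e : A ≃+* B`, the homomorphism
`g ↦ GL_n(e)(ρ g)` is again continuous (its kernel contains the open kernel of `ρ`), so it is a
`FramedGaloisRep F B n`; it has finite image and the same projective image up to `PGL_n(e)`.
Serre, *Abelian ℓ-adic representations* (1968), Ch. I §1.1 (representations with finite image are
continuous for any topology on the coefficients). [folklore] -/
theorem exists_map_ringEquiv (ρ : FramedGaloisRep F A n) [Finite ρ.toMonoidHom.range]
    (e : A ≃+* B) :
    ∃ σ : FramedGaloisRep F B n,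
      σ.toMonoidHom = (Matrix.GeneralLinearGroup.map e.toRingHom).comp ρ.toMonoidHom ∧
      Finite σ.toMonoidHom.range ∧
      Nonempty (projectiveImage σ.toMonoidHom ≃* projectiveImage ρ.toMonoidHom) := by
  set φ : absoluteGaloisGroup F →* GL (Fin n) B :=
    (Matrix.GeneralLinearGroup.map e.toRingHom).comp ρ.toMonoidHom with hφ
  have hker : IsOpen (φ.ker : Set (absoluteGaloisGroup F)) := by
    refine Subgroup.isOpen_mono ?_ (isOpen_ker_of_finite_range ρ)
    intro g hg
    rw [MonoidHom.mem_ker] at hg ⊢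
    rw [hφ, MonoidHom.comp_apply, hg, map_one]
  let σ : FramedGaloisRep F B n :=
    { φ with continuous_toFun := MonoidHom.continuous_of_isOpen_ker φ hker }
  have hσ : σ.toMonoidHom = φ := rfl
  refine ⟨σ, hσ, ?_, ?_⟩
  · rw [hσ, hφ, MonoidHom.range_comp]
    exact Finite.Set.finite_image _ _ |> fun h => by exact_mod_cast h
  · rw [hσ, hφ]
    exact nonempty_projectiveImage_comp_mulEquiv_of_injOn e.toRingHom ρ.toMonoidHom
      (projGenLinGroup_map_injective e).injOn

end Transport

/-! ### Restriction of an icosahedral representation to a quadratic field -/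

section Restrict

variable {A : Type*} [Field A] [CharZero A] [TopologicalSpace A] [IsTopologicalRing A]

/-- **Restriction of an icosahedral Galois representation of `Γ_ℚ` to a quadratic field.**  Let
`σ₀ : Γ_ℚ → GL₂(A)` (any coefficient field `A` of characteristic `0`) have finite image and
projective image `≅ A₅`, and let `K` be a quadratic number field.  Then `σ₀|_{Γ_K}`
(`FramedGaloisRep.restrictField`) has finite image, the SAME projective image
`\bar{σ₀|_K}(Γ_K) = \bar σ₀(Γ_ℚ) ≅ A₅` (`Γ_K ≤ Γ_ℚ` has index `2`, `A₅` is simple of order `60`;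
`projectiveImage_comp_eq_of_index_two`), and is irreducible (`A₅` is not cyclic,
`isIrreducible_of_not_isCyclicType`). [folklore] -/
theorem restrictField_quadratic (σ₀ : FramedGaloisRep ℚ A 2) [Finite σ₀.toMonoidHom.range]
    (e₀ : projectiveImage σ₀.toMonoidHom ≃* alternatingGroup (Fin 5))
    (K : Type) [Field K] [NumberField K] (hK : Module.finrank ℚ K = 2) :
    projectiveImage (σ₀.restrictField K).toMonoidHom = projectiveImage σ₀.toMonoidHom ∧
      Finite (σ₀.restrictField K).toMonoidHom.range ∧
      (σ₀.restrictField K).toGaloisRep.IsIrreducible ∧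
      Nonempty ((Matrix.ProjGenLinGroup.mk.comp (σ₀.restrictField K).toMonoidHom).range ≃*
        alternatingGroup (Fin 5)) := by
  have hσ : (σ₀.restrictField K).toMonoidHom =
      σ₀.toMonoidHom.comp (absGaloisRestrict ℚ K).toMonoidHom := rfl
  have hidx : (absGaloisRestrict ℚ K).toMonoidHom.range.index = 2 := by
    haveI : FiniteDimensional ℚ K := Module.finite_of_finrank_eq_succ hK
    exact hK ▸ (isOpen_range_absGaloisRestrict_and_index ℚ K).2
  have hPI : projectiveImage (σ₀.restrictField K).toMonoidHom = projectiveImage σ₀.toMonoidHom := by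
    rw [hσ]
    exact projectiveImage_comp_eq_of_index_two _ _ hidx
      (isSimpleGroup_of_mulEquiv_alternatingGroup e₀) (card_ne_two_of_mulEquiv_alternatingGroup e₀)
  have eσ : projectiveImage (σ₀.restrictField K).toMonoidHom ≃* alternatingGroup (Fin 5) :=
    (MulEquiv.subgroupCongr hPI).trans e₀
  have hle : (σ₀.restrictField K).toMonoidHom.range ≤ σ₀.toMonoidHom.range := by
    rintro _ ⟨g, rfl⟩
    exact ⟨absGaloisRestrict ℚ K g, rfl⟩
  haveI hfinσ : Finite (σ₀.restrictField K).toMonoidHom.range :=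
    Finite.of_injective _ (Subgroup.inclusion_injective hle)
  exact ⟨hPI, hfinσ, isIrreducible_of_not_isCyclicType (σ₀.restrictField K).toMonoidHom
    (not_isCyclicType_of_mulEquiv_alternatingGroup eσ), ⟨eσ⟩⟩

end Restrict

/-! ### The `ℓ`-adic model of `ρ|_{Γ_K}` for an icosahedral `ρ` and a quadratic field `K` -/

section Model

/-- **The first four conjuncts of `ResidualBianchiDoorMod2`.**  Let `ρ : Γ_ℚ → GL₂(ℂ)` be an Artin
representation of icosahedral type (projective image `≅ A₅`), `ι : ℚ̄_ℓ ≃+* ℂ` a field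
isomorphism and `K` a quadratic number field.  Then there is a continuous
`σ₀ = GL₂(ι⁻¹) ∘ ρ : Γ_ℚ → GL₂(ℚ̄_ℓ)` with finite image and projective image `≅ A₅`, and its
restriction `σ = σ₀|_{Γ_K}` satisfies `ι(σ(g)_{ij}) = ρ|_K(g)_{ij}`, has finite image, projective
image `≅ A₅`, and is irreducible (`restrictField_quadratic`).  No parity hypothesis on `ρ` and no
hypothesis on the prime `ℓ` or on its splitting in `K` is needed. [folklore] -/
theorem exists_padicModel_restrictField {ℓ : ℕ} [Fact ℓ.Prime] (ι : PadicAlgCl ℓ ≃+* ℂ)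
    (ρ : FramedGaloisRep ℚ ℂ 2)
    (hico : Nonempty ((Matrix.ProjGenLinGroup.mk.comp ρ.toMonoidHom).range ≃*
      alternatingGroup (Fin 5)))
    (K : Type) [Field K] [NumberField K] (hK : Module.finrank ℚ K = 2) :
    ∃ σ₀ : FramedGaloisRep ℚ (PadicAlgCl ℓ) 2,
      σ₀.toMonoidHom = (Matrix.GeneralLinearGroup.map ι.symm.toRingHom).comp ρ.toMonoidHom ∧
      Finite σ₀.toMonoidHom.range ∧
      Nonempty (projectiveImage σ₀.toMonoidHom ≃* alternatingGroup (Fin 5)) ∧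
      (∀ (g : absoluteGaloisGroup K) (i j : Fin 2),
          ι ((σ₀.restrictField K g).val i j) = ((FramedGaloisRep.restrictField K ρ) g).val i j) ∧
        Finite (σ₀.restrictField K).toMonoidHom.range ∧
        (σ₀.restrictField K).toGaloisRep.IsIrreducible ∧
        Nonempty ((Matrix.ProjGenLinGroup.mk.comp (σ₀.restrictField K).toMonoidHom).range ≃*
          alternatingGroup (Fin 5)) := by
  haveI : Finite ρ.toMonoidHom.range := finite_range_toMonoidHom ρ
  obtain ⟨σ₀, hσ₀, hfin, ⟨e₀⟩⟩ := exists_map_ringEquiv ρ ι.symm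
  obtain ⟨e⟩ := hico
  haveI := hfin
  obtain ⟨-, hfinK, hirr, hA5⟩ := restrictField_quadratic σ₀ (e₀.trans e) K hK
  refine ⟨σ₀, hσ₀, hfin, ⟨e₀.trans e⟩, fun g i j => ?_, hfinK, hirr, hA5⟩
  have h1 : σ₀.restrictField K g =
      Matrix.GeneralLinearGroup.map ι.symm.toRingHom (ρ (absGaloisRestrict ℚ K g)) := by
    change σ₀.toMonoidHom (absGaloisRestrict ℚ K g) = _
    rw [hσ₀]
    rfl
  rw [h1, FramedGaloisRep.restrictField_apply]
  change ι (ι.symm _) = _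
  exact ι.apply_symm_apply _

end Model

end Summit.Langlands.Langlands.Theorems.ResidualBianchiDoorMod2

end
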